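import Literature.Computability.Complexity.DegreeThreeEncodingEntropy
import Literature.Computability.Complexity.DegreeThreeEncodingMapFP
import HarnessLib

/-!
# Degree reduction for Polynomial Entropy Approximation: `PEA_d ≤ₚ PEA_3` for every `d`

**Theorem** (Dvir–Gutfreund–Rothblum–Vadhan 2010, Thm 4.5 with Claim 4.4; via the perfect degree-3
randomizing polynomials of Ishai–Kushilevitz 2002 / Applebaum–Ishai–Kushilevitz 2006).  For every
`d`, the promise problem `PEA_d` (entropy approximation of degree-`≤ d` sparse polynomial maps over
`F₂`, gap `1` at integer thresholds) Karp-reduces to `PEA_3`: `PEA_polyTimeReducible_three`.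

The reduction is ONE polynomial-time map for all `d` (the degree promise on the input is never
used): `(n, P, k) ↦ (n + m, P', k + m)` where `P'` replaces every output polynomial of `P` by the
degree-3 blocks of its monomials chained by fresh masks (files III–V), `m` fresh variables in all,
so that `H(P'(U_{n+m})) = H(P(U_n)) + m` (file VI) and `deg P' ≤ 3`; computed on the codes of
`PEAInst.encoding` by the typed polynomial-time program of files VII–VIII (`codeFP_reduceRaw`).

* `encode_eq_instE` — the code of an instance is the raw code of `(n, natOf P, k)`;
* `rawOf_reduceInst` — the raw data of the reduced instance is the raw reduction of the raw data;
* `PEA_polyTimeReducible_three : ∀ d, (PEA d).PolyTimeReducible (PEA 3)`.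

## References

* Z. Dvir, D. Gutfreund, G. N. Rothblum, S. Vadhan, *On approximating the entropy of polynomial
  mappings*, ECCC TR10-160 (2010) / ICS 2011, Thm 4.5, Claim 4.4, Thm 4.6.
* Y. Ishai, E. Kushilevitz, ICALP 2002, §3; B. Applebaum, Y. Ishai, E. Kushilevitz, SIAM J. Comput.
  36 (2006), §4.
* O. Goldreich, *On promise problems* (2006), Def. 1.4 (Karp reductions of promise problems).
-/

namespace Literature.Computability.Complexity

namespace RandPoly

open _root_.Computability
open CodeFP (natE pairE rawE listE)

/-- Headed list codes commute with maps of the items. [folklore] -/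
theorem listE_comp {α β : Type} (e : β → List Bool) (f : α → β) :
    (listE fun a => e (f a)) = fun l => listE e (l.map f) := by
  funext l
  simp [CodeFP.listE, CodeFP.rawE, List.map_map, Function.comp_def]

/-- **The code of a `PEA` instance is the raw code of `(n, natOf P, k)`** (variable indices of the
`Fin n`-indexed map written as naturals). [folklore] -/
theorem encode_eq_instE (I : PEAInst) :
    PEAInst.encoding.encode I =
      pairE natE (pairE (listE (listE (listE natE))) natE) (I.1, natOf I.2.1, I.2.2) := by
  obtain ⟨n, P, k⟩ := I
  show boolPair (encodeNat n) (boolPair (((encodingFinBool n).listBool.listBool.listBool).encode P) (encodeNat k)) =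
    boolPair (natE n) (boolPair (listE (listE (listE natE)) (natOf P)) (natE k))
  rw [CodeFP.listE_eq, CodeFP.listE_eq, CodeFP.listE_eq]
  have h1 : (listE (encodingFinBool n).encode) = fun μ : List (Fin n) => listE natE (μ.map Fin.val) :=
    listE_comp natE Fin.val
  have h2 : (listE fun μ : List (Fin n) => listE natE (μ.map Fin.val)) =
      fun q => listE (listE natE) (q.map (List.map Fin.val)) := listE_comp (listE natE) (List.map Fin.val)
  have h3 : (listE fun q : List (List (Fin n)) => listE (listE natE) (q.map (List.map Fin.val))) =
      fun P => listE (listE (listE natE)) (P.map (List.map (List.map Fin.val))) :=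
    listE_comp (listE (listE natE)) (List.map (List.map Fin.val))
  rw [h1, h2, h3]
  rfl

/-- **The raw data of the reduced instance is the raw reduction of the raw data.**
[cite: DvirGutfreundRothblumVadhan2010, Thm 4.5] -/
theorem rawOf_reduceInst (I : PEAInst) :
    ((reduceInst I).1, natOf (reduceInst I).2.1, (reduceInst I).2.2) =
      ((encodeMap I.1 (natOf I.2.1)).1, (encodeMap I.1 (natOf I.2.1)).2,
        I.2.2 + ((encodeMap I.1 (natOf I.2.1)).1 - I.1)) := by
  have hle := le_encodeMap_fst I.1 (natOf I.2.1)
  refine Prod.ext ?_ (Prod.ext ?_ ?_)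
  · show I.1 + freshOf I = _
    unfold freshOf; omega
  · exact natOf_toFinMap _ _ _
  · rfl

/-- **`PEA_d ≤ₚ PEA_3` for every `d`** (Karp reduction of promise problems, one reduction map for
all `d`). [cite: DvirGutfreundRothblumVadhan2010, Thm 4.5] -/
theorem PEA_polyTimeReducible_three (d : ℕ) : (PEA d).PolyTimeReducible (PEA 3) := by
  obtain ⟨F, hF, hFr⟩ := codeFP_reduceRaw
  have hred : ∀ I : PEAInst, F (PEAInst.encoding.encode I) = PEAInst.encoding.encode (reduceInst I) := by
    intro I
    rw [encode_eq_instE, encode_eq_instE, hFr, rawOf_reduceInst]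
  refine ⟨F, hF, fun w hw => ?_, fun w hw => ?_⟩
  · have hw' := hw
    obtain ⟨I, -, rfl⟩ : ∃ I, I ∈ _ ∧ PEAInst.encoding.encode I = w := hw
    rw [hred]
    exact reduceInst_mem_yes hw'
  · have hw' := hw
    obtain ⟨I, -, rfl⟩ : ∃ I, I ∈ _ ∧ PEAInst.encoding.encode I = w := hw
    rw [hred]
    exact reduceInst_mem_no hw'

end RandPoly

/-- **Degree reduction for `PEA`** (root-namespace alias of `RandPoly.PEA_polyTimeReducible_three`):
for every `d`, `PEA_d` Karp-reduces to `PEA_3`. [cite: DvirGutfreundRothblumVadhan2010, Thm 4.5] -/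
theorem PEA_polyTimeReducible_PEA_three (d : ℕ) : (PEA d).PolyTimeReducible (PEA 3) :=
  RandPoly.PEA_polyTimeReducible_three d

end Literature.Computability.Complexity
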